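/-
Copyright (c) 2026 the pub-hodgecm-mathlib formalisation cell (harness21).  Prover seat hodgecm-mathlib-K2E3-p17 (g10), HCML Track B «K2-LIT» ∕ h413
(`stmt-HodgeConjecture-24833`), R90-TF section S3 hand (U3-χ) «OUTRIGHT payer of `stub_R90_S3_auxGlobaliseChar`, hypothesis-first over its key»
(RULING S3-R20 (A), R90-C12-plan (g2) 2026-09-04T23:48:56Z; census `R90/S3/CENSUS-U3-globalise.K2E3-p17-g10.md` + brick census 23:59Z).  2026-09-05.
-/
import Literature.NumberTheory.Automorphic.Arthur2013.Leaves.TorusLocalDatum                -- ★ Weil's extension principle `exists_extension_of_character`, `cpt`, `unitIdelesAway`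
import Summits.HodgeConjecture.HodgeConjecture.Theorems.R90S3AuxGlobaliseCharTransport      -- ★ (T1) `auxGlobaliseChar_local_*`
import Literature.NumberTheory.GaloisRepresentations.CMTypeHeckeCharacter                    -- ★ `HeckeCharacter.infPart_localUnits'`
import HarnessLib

/-!
# R90 · S3 · (U3-χ) — `auxGlobaliseChar_of_key`: the character-globalisation socket from the KEY of Weil's extension principle

R90-TF section S3 (dealer R90-C12-plan (g2), RULING S3-R20 (A) 2026-09-04T23:48:56Z); seat K2E3-p17 (g10); crux H413 = `stmt-HodgeConjecture-24833`
(lane `--kind proof --supports … --as helper`).  THEOREMS ONLY (no `def`, no instance, no notation, no named fact, no `sorry`); ★ imports only.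

THE SOCKET (G `Cruxes/H413/Lines/R90_S3_LocalTransportWaveG.lean` :669–:687, (U3-χ)): given the (U3-F) ring datum `Φ : L ⊗_{L⁺} L⁺_v ≃+* L′ ⊗_{L′⁺} L′⁺_{v′}`
(bi-continuous, conj-intertwining), `v′` non-split (`hv′`), and a Hecke character `μ` of `L` with `μ|_{𝔸_{L⁺}ˣ} = ω` — a UNITARY Hecke character `μ′` of `L′` with
`μ′|_{𝔸_{L′⁺}ˣ} = ω′` (`hμ′ω`), `μ′_{v′} ∘ Φ = μ_v` (`hΦμ`) and `μ′` UNRAMIFIED at every place over every finite `w′ ≠ v′` (⟪U⟫-χ).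

THE ROAD (census KEY FINDING 1): WEIL'S EXTENSION PRINCIPLE ★ `exists_extension_of_character` (`Arthur2013/Leaves/TorusLocalDatum` :176, proved) at
`F₀ := L′⁺`, `K := L′`, `χ₀ := ω′ = quadraticHeckeCharCM L′`, `V := 𝕌^{(w′)}` = ★ `unitIdelesAway w′` (no condition at `∞` and at the unique `w′ ∣ v′`, units elsewhere),
`Φ := Φ_∞ ∘ (·)_∞ · (μ_v ∘ Φ⁻¹) ∘ (·)_{w′}`.  §1 `exists_of_localDatum_twisted` is the `χ₀`-TWISTED form of ★ `exists_of_localDatum` (which is `χ₀ = 1`), hypothesis-first over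
the principle's consistency KEY; its read-off (local component at `u₁`, unramified off `u₁`) is ★'s, with the private one-line helpers of ★ re-proved here (primed names).
§2 `auxGlobaliseChar_of_key` is the CM assembly: the transported local datum `μ_v ∘ Φ⁻¹` (★ T1 `R90S3AuxGlobaliseCharTransport`) read at the single place `w′`
(★ `PlacesOver.subsingleton_of_smul_eq`, `MulEquiv.piUnits`, `Pi.mulSingle`) is continuous (★ `continuous_semilocalComponent`, `ContinuousMulEquiv.piUnits`) and unitary
(`hμu`); the conclusion is the socket's :677–:686 token for token (`hΦμ` via ★ `semilocalComponent_eq_localComponent_of_smul_eq` + ★ T1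
`auxGlobaliseChar_local_apply_unitsMap`; ⟪U⟫-χ because a place over `w″ ≠ v′` is not `w′`).

THE ONE HYPOTHESIS `hKey` (brick χ-key-B, census 23:59Z; TRUE for a suitable ODD-exponent `Φ_∞`, proof = the `ω′`-twisted analogue of ★
`archChar_mul_localDatum_eq_one_of_triple`: for an admissible triple `a_{L′}·y = (k)`, `k∕k̄` is a root of unity (Kronecker), `ω′(a)` unfolds by «`ω′` unramified off `v′`»
(the socket's `hur′`), «`ω′_∞ = sgn`» and the local norm match at `v′` under `Φ` (the socket's `hΦσ`, `hμω`), and `Φ_∞` absorbs signs and roots of unity):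
for every `w′ ∣ v′` and every triple `(a, y, k)` with `y ∈ 𝕌^{(w′)}` and `a_{L′} · y = (k)`: `ω′(a) · Φ_∞(y_∞) · (μ_v ∘ Φ⁻¹)(y_{w′}) = 1`.
PLUG (G ED. n, S3 pen): `stub_R90_S3_auxGlobaliseChar L v L′ v′ Φ hc hc′ hΦσ hur′ hv′ μ hμu hμω := auxGlobaliseChar_of_key L v L′ v′ Φ hc′ hv′ μ hμu Φ_∞ hΦ∞c hΦ∞u (‹χ-key-B›
L v L′ v′ Φ hc hc′ hΦσ hur′ hv′ μ hμω)` once χ-key-B's payer `… : ∃ Φ_∞ …, KEY` (or with a chosen `Φ_∞`) is ★.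
[Rogawski1990, §13.8 p. 212, p. 216] [Weil1956, §1] [Arthur2011Draft, d-p.309 Lemma 6.2.2, d-p.319 Remarks 2–3 (abelian case)]

HONEST LABEL: hypothesis-first — (U3-χ) is paid only when χ-key-B lands and G plugs it; (U3-F) remains the declared residual; HC_CM is proved only modulo the 7
printed citations (2 remaining named inputs: hLiu418 = stmt-HodgeConjecture-24832, h413 = stmt-HodgeConjecture-24833) until rung 0 closes; count-neutral.
-/

set_option autoImplicit false
-- the mandated namespace repeats the single-problem summit's segment (`HodgeConjecture.HodgeConjecture`)
set_option linter.dupNamespace false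

noncomputable section

namespace Summit.HodgeConjecture.HodgeConjecture.R90.S3

open NumberField IsDedekindDomain
open Literature.NumberTheory.GaloisRepresentations
open Literature.NumberTheory.Automorphic IdeleHerbrand
open Literature.NumberTheory.Automorphic.Arthur2013.Leaves.TECR
open Literature.NumberTheory.Automorphic.Arthur2013.Leaves.TECR.TorusDict
open Literature.NumberTheory.GaloisRepresentations.HeckeCharacter
open Literature.NumberTheory.GaloisRepresentations.HeckeCharacter.CMQuadraticExtension
open scoped Topology

/-! ## §1 Weil's extension principle with a prescribed component at one place, TWISTED by a base character `χ₀` -/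

section Generic

variable {F₀ K : Type} [Field F₀] [NumberField F₀] [Field K] [NumberField K] [Algebra F₀ K]

omit [NumberField F₀] in
/-- `x ↦ x_u` is continuous (re-proved: ★ `TorusLocalDatum`'s copy is private). [cite: TateThesis1967, §3.2] -/
theorem continuous_cpt' (u : HeightOneSpectrum (𝓞 K)) : Continuous (cpt (K := K) u) := by
  refine Units.continuous_iff.mpr ⟨continuous_ideleGroup_snd_apply u, ?_⟩
  have : (fun x : ideleGroup K => (((cpt u x)⁻¹ : (u.adicCompletion K)ˣ) : u.adicCompletion K)) =
      fun x => ((x⁻¹ : ideleGroup K) : AdeleRing (𝓞 K) K).2 u := by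
    funext x; rw [← map_inv]; rfl
  rw [this]
  exact (continuous_ideleGroup_snd_apply u).comp continuous_inv

omit [NumberField F₀] in
/-- The `u`-component of `localUnits u x` is `x`. [cite: TateThesis1967, §3.2] -/
theorem cpt_localUnits_self' (u : HeightOneSpectrum (𝓞 K)) (x : (u.adicCompletion K)ˣ) :
    cpt u (localUnits u x) = x :=
  Units.ext (localUnits_snd_apply_self u x)

omit [NumberField F₀] in
/-- The `u`-component of a local idèle at another place is `1`. [cite: TateThesis1967, §3.2] -/
theorem cpt_localUnits_of_ne' {u w : HeightOneSpectrum (𝓞 K)} (h : u ≠ w) (x : (w.adicCompletion K)ˣ) :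
    cpt u (localUnits w x) = 1 :=
  Units.ext (localUnits_snd_apply_of_ne x h)

omit [NumberField F₀] in
/-- `𝕌_K ≤ 𝕌_K^{(u₁)}`. [cite: NeukirchANT1999, Ch. VI §1] -/
theorem unitIdeles_le_unitIdelesAway' (u₁ : HeightOneSpectrum (𝓞 K)) :
    unitIdeles K ≤ unitIdelesAway u₁ := fun _ hx v _ => hx v

omit [NumberField F₀] in
/-- `𝕌_K^{(u₁)}` is a neighbourhood of `1`. [cite: NeukirchANT1999, Ch. VI §1] -/
theorem unitIdelesAway_mem_nhds' (u₁ : HeightOneSpectrum (𝓞 K)) :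
    ((unitIdelesAway u₁ : Subgroup (ideleGroup K)) : Set (ideleGroup K)) ∈ 𝓝 (1 : ideleGroup K) :=
  Filter.mem_of_superset ((isOpen_unitIdeles K).mem_nhds (unitIdeles K).one_mem)
    (unitIdeles_le_unitIdelesAway' u₁)

omit [NumberField F₀] in
/-- Local idèles at `u₁` lie in `𝕌_K^{(u₁)}`. [cite: NeukirchANT1999, Ch. VI §1] -/
theorem localUnits_mem_unitIdelesAway' (u₁ : HeightOneSpectrum (𝓞 K)) (x : (u₁.adicCompletion K)ˣ) :
    localUnits u₁ x ∈ unitIdelesAway u₁ := fun v hv => by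
  rw [localUnits_snd_apply_of_ne x hv, map_one]

omit [NumberField F₀] in
/-- Local UNIT idèles at any finite place lie in `𝕌_K^{(u₁)}`. [cite: NeukirchANT1999, Ch. VI §1] -/
theorem localUnits_integer_mem_unitIdelesAway' (u₁ u : HeightOneSpectrum (𝓞 K))
    (ε : (u.adicCompletionIntegers K)ˣ) :
    localUnits u (Units.map ((u.adicCompletionIntegers K).subtype : _ →* _) ε) ∈ unitIdelesAway u₁ :=
  unitIdeles_le_unitIdelesAway' u₁
    (localUnits_mem_nbhd (∅ : Finset (HeightOneSpectrum (𝓞 K))) (fun _ => 0) (by simp) ε).1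

/-- **Weil's extension principle with a PRESCRIBED COMPONENT at one finite place, twisted by a base character** — the `χ₀`-version of ★
`exists_of_localDatum` (which is `χ₀ = 1`), HYPOTHESIS-FIRST over its key: `χ₀` a unitary Hecke character of `F₀`, `u₁` a finite place of `K`, `π₁` a unitary
continuous character of `K_{u₁}ˣ`, `Φ_∞` a unitary continuous character of `K_∞ˣ`; if `χ₀(a) · Φ_∞(y_∞) · π₁(y_{u₁}) = 1` for every admissible triple `a_K · y = (k)` with `y` a unit
away from `u₁` (`hKey`), then there is a unitary Hecke character `χ` of `K` with `χ ∘ BC = χ₀`, LOCAL COMPONENT `π₁` AT `u₁`, and UNRAMIFIED at every finite `u ≠ u₁`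
(★ `exists_extension_of_character` at `V = 𝕌_K^{(u₁)}`, `Φ = Φ_∞ ∘ (·)_∞ · π₁ ∘ (·)_{u₁}`; the read-off is ★ `exists_of_localDatum`'s).
[cite: Weil1956, §1] [cite: Arthur2011Draft, d-p.309 Lemma 6.2.2 (i)(ii), d-p.319 Remark 2] -/
theorem exists_of_localDatum_twisted (χ₀ : HeckeCharacter F₀) (hχ₀ : χ₀.IsUnitary)
    (Φinf : (InfiniteAdeleRing K)ˣ →* ℂˣ) (hΦinfc : Continuous Φinf) (hΦinfu : ∀ z, ‖(Φinf z : ℂ)‖ = 1)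
    (u₁ : HeightOneSpectrum (𝓞 K)) (π₁ : (u₁.adicCompletion K)ˣ →* ℂˣ) (hπc : Continuous π₁) (hπu : ∀ x, ‖(π₁ x : ℂ)‖ = 1)
    (hKey : ∀ (a : ideleGroup F₀) (y : ideleGroup K) (k : Kˣ), y ∈ unitIdelesAway u₁ →
      AdeleRing.ideleBaseChange F₀ K a * y = Literature.NumberTheory.GaloisRepresentations.principalIdele K k →
      (χ₀ a : ℂ) * ((Φinf (infPart K y) : ℂ) * π₁ (cpt u₁ y)) = 1) :
    ∃ χ : HeckeCharacter K, χ.IsUnitary ∧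
      (∀ x, χ (AdeleRing.ideleBaseChange F₀ K x) = χ₀ x) ∧
      χ.localComponent u₁ = π₁ ∧
      ∀ u : HeightOneSpectrum (𝓞 K), u ≠ u₁ → χ.IsUnramifiedAt u := by
  classical
  let Φm : ideleGroup K →* ℂˣ := (Φinf.comp (infPart K)) * (π₁.comp (cpt u₁))
  have hΦm : ∀ y, Φm y = Φinf (infPart K y) * π₁ (cpt u₁ y) := fun y => rfl
  have hΦcont : Continuous Φm :=
    (hΦinfc.comp continuous_infPart).mul (hπc.comp (continuous_cpt' u₁))
  let Φ : ideleGroup K →ₜ* ℂˣ := ⟨Φm, hΦcont⟩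
  have hΦ : ∀ y, (Φ y : ℂ) = (Φinf (infPart K y) : ℂ) * π₁ (cpt u₁ y) := fun y => by
    change ((Φm y : ℂˣ) : ℂ) = _
    rw [hΦm, Units.val_mul]
  have hΦu : ∀ y, ‖(Φ y : ℂ)‖ = 1 := fun y => by
    rw [hΦ, norm_mul, hΦinfu, hπu, mul_one]
  obtain ⟨χ, hχu, hχres, hχV⟩ := exists_extension_of_character χ₀ hχ₀
    (unitIdelesAway u₁) (unitIdelesAway_mem_nhds' u₁) Φ hΦu
    (fun a y k hyV h => by rw [hΦ]; exact hKey a y k hyV h)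
  refine ⟨χ, hχu, hχres, ?_, ?_⟩
  · -- the local component at `u₁`
    ext x
    rw [HeckeCharacter.localComponent_apply]
    have h1 := hχV _ (localUnits_mem_unitIdelesAway' u₁ x)
    rw [hΦ, infPart_localUnits', map_one, Units.val_one, one_mul, cpt_localUnits_self'] at h1
    exact congrArg _ (Units.ext h1)
  · -- unramified away from `u₁`
    intro u hu ε
    rw [HeckeCharacter.localComponent_apply]
    apply Units.ext
    rw [hχV _ (localUnits_integer_mem_unitIdelesAway' u₁ u ε), hΦ, infPart_localUnits', map_one, Units.val_one,
      one_mul, cpt_localUnits_of_ne' (Ne.symm hu), map_one, Units.val_one]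

end Generic

/-! ## §2 The CM assembly: (U3-χ)'s conclusion from the key -/

section CM

open Literature.NumberTheory.Automorphic.UnitaryGroup Literature.NumberTheory.Rogawski1990

variable (L : Type) [Field L] [NumberField L] [IsCMField L] (v : HeightOneSpectrum (𝓞 ↥(maximalRealSubfield L)))
  (L' : Type) [Field L'] [NumberField L'] [IsCMField L'] (v' : HeightOneSpectrum (𝓞 ↥(maximalRealSubfield L')))

open scoped Classical in
omit [IsCMField L'] in
/-- Reading a unit of `L′ ⊗ L′⁺_{v′} = ∏_{w ∣ v′} L′_w` at the unique place `w′ ∣ v′` and re-inserting it is the identity (non-split `v′`).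
[cite: CasselsFrohlichANT1967, Ch. II §10] -/
theorem piUnits_symm_mulSingle_piUnits (w' : UnitaryGroup.PlacesOver L' v') (hw : ∀ w : UnitaryGroup.PlacesOver L' v', w = w')
    (U : (UnitaryGroup.LocalRing L' v')ˣ) :
    (MulEquiv.piUnits (M := fun w : UnitaryGroup.PlacesOver L' v' => w.1.adicCompletion L')).symm
        (Pi.mulSingle w' (MulEquiv.piUnits U w')) = U := by
  apply (MulEquiv.piUnits (M := fun w : UnitaryGroup.PlacesOver L' v' => w.1.adicCompletion L')).injective
  rw [MulEquiv.apply_symm_apply]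
  funext w
  obtain rfl := hw w
  rw [Pi.mulSingle_eq_same]

open scoped Classical in
omit [IsCMField L] in
/-- **(U3-χ) FROM ITS KEY** — the socket `stub_R90_S3_auxGlobaliseChar` (`Cruxes/H413/Lines/R90_S3_LocalTransportWaveG.lean` :669; conclusion :677–:686 token for token),
HYPOTHESIS-FIRST over the consistency key `hKey` of Weil's extension principle at the datum `(ω′ ; 𝕌^{(w′)} ; Φ_∞ · (μ_v ∘ Φ⁻¹)_{w′})` (brick χ-key-B of the census;
`Φ_∞` = a unitary continuous archimedean character, part of the key's data — its payer takes odd angular exponents absorbing the signs at the real places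
and the roots of unity of `L′`).  The socket's binders `hc`, `hΦσ`, `hur′`, `hμω` are not used here (they are inputs of `hKey`'s payer) and are therefore absent. [cite: Rogawski1990, §13.8 p. 212, p. 216] [cite: Weil1956, §1] [cite: Arthur2011Draft, d-p.309 Lemma 6.2.2] -/
theorem auxGlobaliseChar_of_key
    (Φ : UnitaryGroup.LocalRing L v ≃+* UnitaryGroup.LocalRing L' v') (hc' : Continuous Φ.symm)
    (hv' : ∀ w' : UnitaryGroup.PlacesOver L' v', IsCMField.complexConj L' • w'.1 = w'.1)
    (μ : HeckeCharacter L) (hμu : μ.IsUnitary)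
    (Φinf : (InfiniteAdeleRing L')ˣ →* ℂˣ) (hΦinfc : Continuous Φinf) (hΦinfu : ∀ z, ‖(Φinf z : ℂ)‖ = 1)
    (hKey : ∀ (w' : UnitaryGroup.PlacesOver L' v') (a : ideleGroup ↥(maximalRealSubfield L')) (y : ideleGroup L') (k : L'ˣ),
      y ∈ unitIdelesAway w'.1 →
      AdeleRing.ideleBaseChange (↥(maximalRealSubfield L')) L' a * y = Literature.NumberTheory.GaloisRepresentations.principalIdele L' k →
      (quadraticHeckeCharCM L' a : ℂ) * ((Φinf (infPart L' y) : ℂ) *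
        ((μ.semilocalComponent L v).comp (Units.map (Φ.symm : UnitaryGroup.LocalRing L' v' →+* UnitaryGroup.LocalRing L v).toMonoidHom))
          ((MulEquiv.piUnits (M := fun w : UnitaryGroup.PlacesOver L' v' => w.1.adicCompletion L')).symm (Pi.mulSingle w' (cpt w'.1 y)))) = 1) :
    ∃ μ' : HeckeCharacter L',
      μ'.IsUnitary ∧
      (∀ x : Literature.NumberTheory.GaloisRepresentations.ideleGroup ↥(maximalRealSubfield L'),
        μ' (AdeleRing.ideleBaseChange (↥(maximalRealSubfield L')) L' x) = quadraticHeckeCharCM L' x) ∧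
      (∀ u : (UnitaryGroup.LocalRing L v)ˣ,
        μ'.semilocalComponent L' v' (Units.map (Φ : UnitaryGroup.LocalRing L v →+* UnitaryGroup.LocalRing L' v').toMonoidHom u) = μ.semilocalComponent L v u) ∧
      (∀ w' : HeightOneSpectrum (𝓞 ↥(maximalRealSubfield L')), w' ≠ v' → ∀ W : UnitaryGroup.PlacesOver L' w', μ'.IsUnramifiedAt W.1) := by
  obtain ⟨w'⟩ : Nonempty (UnitaryGroup.PlacesOver L' v') := inferInstance
  have hsub : ∀ w : UnitaryGroup.PlacesOver L' v', w = w' := fun w =>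
    (UnitaryGroup.PlacesOver.subsingleton_of_smul_eq (IsCMField.complexConj L') (IsCMField.complexConj_ne_one L') w' (hv' w')).elim w w'
  -- the transported local datum, read at the single place `w′`
  set ν : (UnitaryGroup.LocalRing L' v')ˣ →* ℂˣ :=
    (μ.semilocalComponent L v).comp (Units.map (Φ.symm : UnitaryGroup.LocalRing L' v' →+* UnitaryGroup.LocalRing L v).toMonoidHom) with hν
  set g : (w'.1.adicCompletion L')ˣ →* (UnitaryGroup.LocalRing L' v')ˣ :=
    (MulEquiv.piUnits (M := fun w : UnitaryGroup.PlacesOver L' v' => w.1.adicCompletion L')).symm.toMonoidHom.comp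
      (MonoidHom.mulSingle (fun w : UnitaryGroup.PlacesOver L' v' => (w.1.adicCompletion L')ˣ) w') with hg
  have hg_apply : ∀ x, g x = (MulEquiv.piUnits (M := fun w : UnitaryGroup.PlacesOver L' v' => w.1.adicCompletion L')).symm (Pi.mulSingle w' x) :=
    fun _ => rfl
  set π₁ : (w'.1.adicCompletion L')ˣ →* ℂˣ := ν.comp g with hπ₁
  -- continuity and unitarity of `π₁`
  have hνc : Continuous ν := (UnitaryGroup.continuous_semilocalComponent L μ).comp
    (Continuous.units_map (Φ.symm : UnitaryGroup.LocalRing L' v' →+* UnitaryGroup.LocalRing L v).toMonoidHom hc')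
  have hgc : Continuous g := by
    have h1 : Continuous fun x : (w'.1.adicCompletion L')ˣ =>
        (ContinuousMulEquiv.piUnits (M := fun w : UnitaryGroup.PlacesOver L' v' => w.1.adicCompletion L')).symm (Pi.mulSingle w' x) :=
      (ContinuousMulEquiv.piUnits (M := fun w : UnitaryGroup.PlacesOver L' v' => w.1.adicCompletion L')).symm.continuous.comp
        (_root_.continuous_mulSingle (A := fun w : UnitaryGroup.PlacesOver L' v' => (w.1.adicCompletion L')ˣ) w')
    exact h1
  have hπc : Continuous π₁ := hνc.comp hgc
  have hπu : ∀ x, ‖(π₁ x : ℂ)‖ = 1 := fun x => by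
    rw [hπ₁, MonoidHom.comp_apply, hν, MonoidHom.comp_apply, UnitaryGroup.semilocalComponent_apply]
    exact hμu _
  -- Weil's principle, twisted by `ω′`
  obtain ⟨χ, hχu, hχres, hχloc, hχunr⟩ := exists_of_localDatum_twisted (quadraticHeckeCharCM L') (fun x => norm_quadraticHeckeCharCM_apply L' x)
    Φinf hΦinfc hΦinfu w'.1 π₁ hπc hπu (fun a y k hy h => by rw [hπ₁, MonoidHom.comp_apply, hg_apply]; exact hKey w' a y k hy h)
  refine ⟨χ, hχu, hχres, fun u => ?_, fun w'' hw'' W => hχunr W.1 fun hW => hw'' ?_⟩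
  · -- the `v′`-component through `Φ`
    rw [UnitaryGroup.semilocalComponent_eq_localComponent_of_smul_eq L' (IsCMField.complexConj L') (IsCMField.complexConj_ne_one L') w' (hv' w') χ,
      hχloc, hπ₁, MonoidHom.comp_apply, hg_apply, piUnits_symm_mulSingle_piUnits L' v' w' hsub, hν]
    exact auxGlobaliseChar_local_apply_unitsMap L v L' v' Φ μ u
  · -- a place over `w″ ≠ v′` is not `w′`
    rw [← W.2, ← w'.2, hW]

end CM

end Summit.HodgeConjecture.HodgeConjecture.R90.S3

end
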